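import Literature.Combinatorics.LorentzianPolynomials.IndependencePolynomialLorentzian
import Literature.Combinatorics.LorentzianPolynomials.MathlibMatroid
import Literature.Combinatorics.LorentzianPolynomials.RayleighOptimalHigherDegree
import HarnessLib

/-!
# Lorentzian measures and negative dependence for matroids (Brändén–Huh 2020, §4.5 Def. 4.20, Props. 4.21, 4.25; §1)

Layer `Literature/Combinatorics/LorentzianPolynomials`, namespace `Literature.Combinatorics.LorentzianPolynomials`;
lane `lit-hodgefound` (Track 2 foundations library), seat p16, generation 29 (row g29-#5). Brändén–Huh advertise, as an
application of the Lorentzian property of the independence polynomial of a matroid (Thm. 4.10, `q → 0`; tree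
`indepGenPoly_mem_lorentzian`) and of Prop. 2.19 (`L^d_n` is `2(1 - 1/d)`-Rayleigh; tree
`isCRayleigh_two_of_mem_lorentzian`), the negative-dependence inequality
`Pr(F ∋ i, j) ≤ 2 Pr(F ∋ i) Pr(F ∋ j)` for a uniformly random independent set `F` of any matroid. This file proves
it (and its analogue for uniformly random bases, via Thm. 3.10, tree `basisGenPoly_mem_lorentzian`), together with
the §4.5 vocabulary: Lorentzian measures (Def. 4.20), "Lorentzian ⟹ 2-Rayleigh" (Prop. 4.21), and "`μ_M`, `ν_M` are
Lorentzian" (Prop. 4.25).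

## Source (verbatim) — P. Brändén, J. Huh, *Lorentzian polynomials* [BrandenHuh2019] (held `paper:arxiv-1902.03719`)

§1 (p. 7): "The Lorentzian property of the measure `μ_M` shows that, for any matroid `M` and distinct elements `i` and
`j`, `Pr(F contains i and j) ≤ 2 Pr(F contains i) Pr(F contains j)`, where `F` is an independent set of `M` chosen
uniformly at random." §4.5 (pp. 58–60): "More generally, for a positive real number `c`, we say that `μ` is
`c`-Rayleigh if `Z_μ(w) ∂_i∂_j Z_μ(w) ≤ c ∂_i Z_μ(w) ∂_j Z_μ(w)` for all distinct `i, j` in `[n]` and all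
`w ∈ ℝ^n_{>0}`. **Definition 4.20.** A discrete probability measure `μ` on `{0,1}^n` is *Lorentzian* if the
homogenization of the partition function `w_0^n Z_μ(w_1/w_0, …, w_n/w_0)` is a Lorentzian polynomial. […]
**Proposition 4.21.** If `μ` is Lorentzian, then `μ` is `2`-Rayleigh. *Proof.* Lemma 2.20 and Proposition 2.19 show
that `Z_μ` is a `2(1 - 1/n)`-Rayleigh polynomial. […] For a matroid `M` on `[n]`, we define probability measures
`μ_M` and `ν_M` on `{0,1}^n` by `μ_M` = the uniform measure on `{0,1}^n` concentrated on the independent sets of `M`,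
`ν_M` = the uniform measure on `{0,1}^n` concentrated on the bases of `M`. **Proposition 4.25.** For any matroid `M`
on `[n]`, the measures `μ_M` and `ν_M` are Lorentzian. *Proof.* Note that the homogenized partition function `f_M` of
`μ_M` satisfies `f_M(w_0, w_1, …, w_n) = lim_{q → 0} Z_{q,M}(w_0, q w_1, …, q w_n)`. Since a limit of Lorentzian
polynomials is Lorentzian, `μ_M` is Lorentzian by Theorem 4.10. The partition function of `ν_M` is Lorentzian by
Theorem 3.10. […] A conjecture of Kahn [Kah00] and Grimmett–Winkler [GW04] states that, if `F` is a forest in `G`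
chosen uniformly at random, then `Pr(F contains i and j) ≤ Pr(F contains i) Pr(F contains j)`. The conjecture is
equivalent to the statement that `μ_M` is `1`-Rayleigh for any graphic matroid `M`. Propositions 4.21 and 4.25 show
that `μ_M` is `2`-Rayleigh for any matroid `M`."

## What is here

* §1 generating polynomials `f_J = Σ_{α ∈ J} w^α` at the point `𝟙`: `f_J(𝟙) = #J`, `∂_i f_J(𝟙) = Σ_{α∈J} α_i`,
  `∂_i∂_j f_J(𝟙) = Σ_{α∈J} α_i α_j` (`i ≠ j`).
* §2 for a matroid `M` on the finite type `σ`: `f_M(𝟙)`, `∂_i f_M(𝟙)`, `∂_i∂_j f_M(𝟙)` count the independent sets, those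
  containing `i`, those containing `i` and `j` (`f_M = indepGenPoly M`, `i ↦ w_{some i}`, `w_0 = w_{none}`); likewise
  for the basis generating polynomial and the bases.
* §3 **the negative-dependence inequalities**: `#{I ∋ i, j} · #{I} ≤ 2 · #{I ∋ i} · #{I ∋ j}` over the independent
  sets (`ncard_indep_inter_mul_le`, and its probability form `prob_indep_pair_le`), and the same over the bases
  (`ncard_isBase_inter_mul_le`) — Def. 2.18 with `c = 2`, `α = 0`, `w = 𝟙`.
* §4 **Definition 4.20** (`homPartitionPoly μ`, `IsLorentzianMeasure μ`, for a weight `μ` on the subsets of `σ`; a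
  positive normalisation does not matter), **Proposition 4.21** (`IsLorentzianMeasure.isCRayleigh_two`, and the
  printed inequality at every point of the closed orthant of the homogenising variables,
  `IsLorentzianMeasure.eval_mul_le`), **Proposition 4.25** (`isLorentzianMeasure_indepIndicator`: the homogenised
  partition function of `μ_M` IS `f_M`; `isLorentzianMeasure_baseIndicator`: that of `ν_M` is
  `w_0^{n-r} · f_{B(M)}(w)`, Lorentzian by Thm. 3.10, Cor. 2.32 and `w_0^{n-r} ∈ L^{n-r}`).

Five definitions with bodies (`indepSetFamily`, `baseSetFamily`, `homPartitionPoly`, `IsLorentzianMeasure`,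
`setIndicatorWeight`), theorems otherwise; no `sorry`, no named fact (net debt 0). Not treated: Props. 4.22–4.24
(ULC via Example 2.26, symmetric exclusion via Cor. 3.9, strongly Rayleigh via Prop. 2.2).

## References

* [BrandenHuh2019] P. Brändén, J. Huh, *Lorentzian polynomials*, Ann. of Math. (2) 192 (2020) 821–891, arXiv:1902.03719 —
  §1 (p. 7), §4.5 Def. 4.20, Prop. 4.21, Prop. 4.25 (pp. 58–60); §2.4 Def. 2.18, Prop. 2.19; §3.2 Thm. 3.10; §4.3
  Thm. 4.10.
-/

noncomputable section

open MvPolynomial Finsupp Finset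

namespace Literature.Combinatorics.LorentzianPolynomials

/-! ## §1 Generating polynomials and their derivatives at `𝟙` -/

section GenPolyAtOne

variable {τ : Type*}

/-- `(a w^s)(𝟙) = a`. [cite: BrandenHuh2019, §4.5 (evaluating partition functions)] -/
theorem eval_one_monomial (s : τ →₀ ℕ) (a : ℝ) : eval (fun _ ↦ (1 : ℝ)) (monomial s a) = a := by
  rw [eval_monomial]
  simp [Finsupp.prod]

/-- `f_J(𝟙) = #J`. [cite: BrandenHuh2019, §4.5 Def. 4.20 (`Z_μ` at a point), §3.2 Thm. 3.10 (`f_J`)] -/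
theorem eval_one_genPoly (J : Finset (τ →₀ ℕ)) : eval (fun _ ↦ (1 : ℝ)) (genPoly J) = J.card := by
  rw [genPoly_def, map_sum]
  simp_rw [eval_one_monomial]
  rw [Finset.sum_const, nsmul_eq_mul, mul_one]

/-- `∂_i f_J(𝟙) = Σ_{α ∈ J} α_i`. [cite: BrandenHuh2019, §4.5 (the `c`-Rayleigh condition for `Z_μ`)] -/
theorem eval_one_pderiv_genPoly (J : Finset (τ →₀ ℕ)) (i : τ) :
    eval (fun _ ↦ (1 : ℝ)) (pderiv i (genPoly J)) = ∑ α ∈ J, (α i : ℝ) := by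
  rw [genPoly_def, map_sum, map_sum]
  refine Finset.sum_congr rfl fun α _ ↦ ?_
  rw [pderiv_monomial, eval_one_monomial, one_mul]

/-- `∂_i∂_j f_J(𝟙) = Σ_{α ∈ J} α_i α_j` for `i ≠ j`. [cite: BrandenHuh2019, §4.5 (the `c`-Rayleigh condition for `Z_μ`)] -/
theorem eval_one_pderiv_pderiv_genPoly (J : Finset (τ →₀ ℕ)) {i j : τ} (hij : i ≠ j) :
    eval (fun _ ↦ (1 : ℝ)) (pderiv i (pderiv j (genPoly J))) = ∑ α ∈ J, (α i : ℝ) * α j := by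
  rw [genPoly_def, map_sum, map_sum, map_sum]
  refine Finset.sum_congr rfl fun α _ ↦ ?_
  rw [pderiv_monomial, pderiv_monomial, eval_one_monomial, one_mul, Finsupp.tsub_apply,
    Finsupp.single_eq_of_ne hij, tsub_zero, mul_comm]

end GenPolyAtOne

/-! ## §2 Counting independent sets and bases with `f_M(𝟙)` and its derivatives -/

section Counting

variable {σ : Type*} [Fintype σ] [DecidableEq σ]

/-- The finite family of independent sets of a matroid on the finite type `σ`. [cite: BrandenHuh2019, §4.5 (`μ_M`,
"the independent sets of `M`")] -/
def indepSetFamily (M : Matroid σ) : Finset (Set σ) := (Set.toFinite {I : Set σ | M.Indep I}).toFinset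

/-- The finite family of bases of a matroid on the finite type `σ`. [cite: BrandenHuh2019, §4.5 (`ν_M`, "the bases of
`M`")] -/
def baseSetFamily (M : Matroid σ) : Finset (Set σ) := (Set.toFinite {B : Set σ | M.IsBase B}).toFinset

omit [DecidableEq σ] in
/-- Membership in `indepSetFamily`. [cite: BrandenHuh2019, §4.5] -/
theorem mem_indepSetFamily {M : Matroid σ} {I : Set σ} : I ∈ indepSetFamily M ↔ M.Indep I := by
  rw [indepSetFamily, Set.Finite.mem_toFinset]
  rfl

omit [DecidableEq σ] in
/-- Membership in `baseSetFamily`. [cite: BrandenHuh2019, §4.5] -/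
theorem mem_baseSetFamily {M : Matroid σ} {B : Set σ} : B ∈ baseSetFamily M ↔ M.IsBase B := by
  rw [baseSetFamily, Set.Finite.mem_toFinset]
  rfl

omit [DecidableEq σ] in
/-- `#(independent sets satisfying p)` as a set cardinality. [cite: BrandenHuh2019, §4.5] -/
theorem card_filter_indepSetFamily (M : Matroid σ) (p : Set σ → Prop) [DecidablePred p] :
    ((indepSetFamily M).filter p).card = {I : Set σ | M.Indep I ∧ p I}.ncard := by
  rw [Set.ncard_eq_toFinset_card _ (Set.toFinite _)]
  congr 1
  ext I
  simp [mem_indepSetFamily, Set.Finite.mem_toFinset]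

omit [DecidableEq σ] in
/-- `#(bases satisfying p)` as a set cardinality. [cite: BrandenHuh2019, §4.5] -/
theorem card_filter_baseSetFamily (M : Matroid σ) (p : Set σ → Prop) [DecidablePred p] :
    ((baseSetFamily M).filter p).card = {B : Set σ | M.IsBase B ∧ p B}.ncard := by
  rw [Set.ncard_eq_toFinset_card _ (Set.toFinite _)]
  congr 1
  ext B
  simp [mem_baseSetFamily, Set.Finite.mem_toFinset]

omit [DecidableEq σ] in
/-- `#(independent sets)` as a set cardinality. [cite: BrandenHuh2019, §4.5] -/
theorem card_indepSetFamily (M : Matroid σ) : (indepSetFamily M).card = {I : Set σ | M.Indep I}.ncard := by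
  rw [indepSetFamily, ← Set.ncard_eq_toFinset_card]

omit [DecidableEq σ] in
/-- `#(bases)` as a set cardinality. [cite: BrandenHuh2019, §4.5] -/
theorem card_baseSetFamily (M : Matroid σ) : (baseSetFamily M).card = {B : Set σ | M.IsBase B}.ncard := by
  rw [baseSetFamily, ← Set.ncard_eq_toFinset_card]

/-- The exponents of `f_M` are the homogenised indicators of the independent sets. [cite: BrandenHuh2019, §4.3
proof of Thm. 4.14 (`f_M = Σ_I w^I w_0^{n-|I|}`)] -/
theorem indepExp_eq_image (M : Matroid σ) : indepExp M = (indepSetFamily M).image homIndSet := by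
  ext α
  rw [mem_indepExp, Finset.mem_image]
  simp only [mem_indepSetFamily]

/-- The exponents of the basis generating polynomial are the indicators of the bases. [cite: BrandenHuh2019, §3.2
Thm. 3.10] -/
theorem basesExp_eq_image (M : Matroid σ) : basesExp M = (baseSetFamily M).image indSet := by
  ext α
  rw [mem_basesExp, Finset.mem_image]
  simp only [mem_baseSetFamily]

/-- Sums over the exponents of `f_M` are sums over independent sets. [cite: BrandenHuh2019, §4.3, §4.5] -/
theorem sum_indepExp (M : Matroid σ) {β : Type*} [AddCommMonoid β] (g : (Option σ →₀ ℕ) → β) :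
    ∑ α ∈ indepExp M, g α = ∑ I ∈ indepSetFamily M, g (homIndSet I) := by
  rw [indepExp_eq_image, Finset.sum_image fun I _ J _ h ↦ homIndSet_injective h]

/-- Sums over the exponents of the basis generating polynomial are sums over bases. [cite: BrandenHuh2019, §3.2, §4.5] -/
theorem sum_basesExp (M : Matroid σ) {β : Type*} [AddCommMonoid β] (g : (σ →₀ ℕ) → β) :
    ∑ α ∈ basesExp M, g α = ∑ B ∈ baseSetFamily M, g (indSet B) := by
  rw [basesExp_eq_image, Finset.sum_image fun I _ J _ h ↦ indSet_injective h]

/-- **`f_M(𝟙)` is the number of independent sets.** [cite: BrandenHuh2019, §4.5 (`μ_M`), §1 (p. 7)] -/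
theorem eval_one_indepGenPoly (M : Matroid σ) :
    eval (fun _ ↦ (1 : ℝ)) (indepGenPoly M) = {I : Set σ | M.Indep I}.ncard := by
  rw [indepGenPoly, eval_one_genPoly, indepExp_eq_image, Finset.card_image_of_injective _ homIndSet_injective,
    card_indepSetFamily]

/-- **`∂_i f_M(𝟙)` is the number of independent sets containing `i`.** [cite: BrandenHuh2019, §4.5, §1 (p. 7)] -/
theorem eval_one_pderiv_indepGenPoly (M : Matroid σ) (i : σ) :
    eval (fun _ ↦ (1 : ℝ)) (pderiv (some i) (indepGenPoly M)) = {I : Set σ | M.Indep I ∧ i ∈ I}.ncard := by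
  classical
  rw [indepGenPoly, eval_one_pderiv_genPoly, sum_indepExp, ← card_filter_indepSetFamily, ← Finset.sum_boole]
  refine Finset.sum_congr rfl fun I _ ↦ ?_
  rw [homIndSet_some, indSet_apply]
  split_ifs <;> simp

/-- **`∂_i∂_j f_M(𝟙)` is the number of independent sets containing `i` and `j`** (`i ≠ j`).
[cite: BrandenHuh2019, §4.5, §1 (p. 7)] -/
theorem eval_one_pderiv_pderiv_indepGenPoly (M : Matroid σ) {i j : σ} (hij : i ≠ j) :
    eval (fun _ ↦ (1 : ℝ)) (pderiv (some i) (pderiv (some j) (indepGenPoly M))) =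
      {I : Set σ | M.Indep I ∧ i ∈ I ∧ j ∈ I}.ncard := by
  classical
  rw [indepGenPoly, eval_one_pderiv_pderiv_genPoly _ (fun h ↦ hij (Option.some_injective σ h)), sum_indepExp,
    ← card_filter_indepSetFamily, ← Finset.sum_boole]
  refine Finset.sum_congr rfl fun I _ ↦ ?_
  rw [homIndSet_some, homIndSet_some, indSet_apply, indSet_apply]
  split_ifs <;> simp_all

/-- `f_{B(M)}(𝟙)` is the number of bases. [cite: BrandenHuh2019, §4.5 (`ν_M`)] -/
theorem eval_one_basisGenPoly (M : Matroid σ) :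
    eval (fun _ ↦ (1 : ℝ)) (basisGenPoly M) = {B : Set σ | M.IsBase B}.ncard := by
  rw [basisGenPoly, eval_one_genPoly, basesExp_eq_image, Finset.card_image_of_injective _ indSet_injective,
    card_baseSetFamily]

/-- `∂_i f_{B(M)}(𝟙)` is the number of bases containing `i`. [cite: BrandenHuh2019, §4.5 (`ν_M`)] -/
theorem eval_one_pderiv_basisGenPoly (M : Matroid σ) (i : σ) :
    eval (fun _ ↦ (1 : ℝ)) (pderiv i (basisGenPoly M)) = {B : Set σ | M.IsBase B ∧ i ∈ B}.ncard := by
  classical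
  rw [basisGenPoly, eval_one_pderiv_genPoly, sum_basesExp, ← card_filter_baseSetFamily, ← Finset.sum_boole]
  refine Finset.sum_congr rfl fun B _ ↦ ?_
  rw [indSet_apply]
  split_ifs <;> simp

/-- `∂_i∂_j f_{B(M)}(𝟙)` is the number of bases containing `i` and `j` (`i ≠ j`). [cite: BrandenHuh2019, §4.5 (`ν_M`)] -/
theorem eval_one_pderiv_pderiv_basisGenPoly (M : Matroid σ) {i j : σ} (hij : i ≠ j) :
    eval (fun _ ↦ (1 : ℝ)) (pderiv i (pderiv j (basisGenPoly M))) = {B : Set σ | M.IsBase B ∧ i ∈ B ∧ j ∈ B}.ncard := by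
  classical
  rw [basisGenPoly, eval_one_pderiv_pderiv_genPoly _ hij, sum_basesExp, ← card_filter_baseSetFamily,
    ← Finset.sum_boole]
  refine Finset.sum_congr rfl fun B _ ↦ ?_
  rw [indSet_apply, indSet_apply]
  split_ifs <;> simp_all

end Counting

/-! ## §3 Negative dependence: `Pr(F ∋ i, j) ≤ 2 Pr(F ∋ i) Pr(F ∋ j)` -/

section NegativeDependence

variable {σ : Type*} [Fintype σ] [DecidableEq σ]

/-- **Brändén–Huh (§1, p. 7; §4.5 Props. 4.21 and 4.25): for any matroid `M` and distinct elements `i`, `j`,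
`#{I ∈ 𝓘(M) : i, j ∈ I} · #𝓘(M) ≤ 2 · #{I ∈ 𝓘(M) : i ∈ I} · #{I ∈ 𝓘(M) : j ∈ I}`** — "`μ_M` is `2`-Rayleigh for any
matroid `M`": the independence polynomial `f_M` is Lorentzian (Thm. 4.10 at `q → 0`), hence `2(1 - 1/n)`- and so
`2`-Rayleigh (Prop. 2.19), and Def. 2.18 with `α = 0` at `w = 𝟙` is this inequality. [cite: BrandenHuh2019, §1 (p. 7);
§4.5 Prop. 4.21, Prop. 4.25 (p. 59), and the closing remark (p. 60)] -/
theorem ncard_indep_inter_mul_le (M : Matroid σ) {i j : σ} (hij : i ≠ j) :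
    {I : Set σ | M.Indep I}.ncard * {I : Set σ | M.Indep I ∧ i ∈ I ∧ j ∈ I}.ncard ≤
      2 * ({I : Set σ | M.Indep I ∧ i ∈ I}.ncard * {I : Set σ | M.Indep I ∧ j ∈ I}.ncard) := by
  have h := (isCRayleigh_two_of_mem_lorentzian (indepGenPoly_mem_lorentzian M)).eval_mul_eval_pderiv_pderiv_le
    (some i) (some j) (w := fun _ ↦ (1 : ℝ)) fun _ ↦ zero_le_one
  rw [eval_one_indepGenPoly, eval_one_pderiv_pderiv_indepGenPoly M hij, eval_one_pderiv_indepGenPoly,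
    eval_one_pderiv_indepGenPoly] at h
  exact_mod_cast h

/-- **"`Pr(F contains i and j) ≤ 2 Pr(F contains i) Pr(F contains j)`, where `F` is an independent set of `M` chosen
uniformly at random"** (probabilities as ratios of counts). [cite: BrandenHuh2019, §1 (p. 7); §4.5 Props. 4.21, 4.25] -/
theorem prob_indep_pair_le (M : Matroid σ) {i j : σ} (hij : i ≠ j) :
    ({I : Set σ | M.Indep I ∧ i ∈ I ∧ j ∈ I}.ncard : ℝ) / {I : Set σ | M.Indep I}.ncard ≤
      2 * (({I : Set σ | M.Indep I ∧ i ∈ I}.ncard : ℝ) / {I : Set σ | M.Indep I}.ncard) *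
        (({I : Set σ | M.Indep I ∧ j ∈ I}.ncard : ℝ) / {I : Set σ | M.Indep I}.ncard) := by
  have hN : (0 : ℝ) < {I : Set σ | M.Indep I}.ncard := by
    have h1 : 0 < {I : Set σ | M.Indep I}.ncard :=
      Set.ncard_pos (Set.toFinite _) |>.2 ⟨∅, M.empty_indep⟩
    exact_mod_cast h1
  have h := ncard_indep_inter_mul_le M hij
  have h' : ({I : Set σ | M.Indep I}.ncard : ℝ) * {I : Set σ | M.Indep I ∧ i ∈ I ∧ j ∈ I}.ncard ≤
      2 * (({I : Set σ | M.Indep I ∧ i ∈ I}.ncard : ℝ) * {I : Set σ | M.Indep I ∧ j ∈ I}.ncard) := by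
    exact_mod_cast h
  rw [div_le_iff₀ hN]
  calc ({I : Set σ | M.Indep I ∧ i ∈ I ∧ j ∈ I}.ncard : ℝ)
      = ({I : Set σ | M.Indep I}.ncard : ℝ) * {I : Set σ | M.Indep I ∧ i ∈ I ∧ j ∈ I}.ncard /
          {I : Set σ | M.Indep I}.ncard := by field_simp
    _ ≤ 2 * (({I : Set σ | M.Indep I ∧ i ∈ I}.ncard : ℝ) * {I : Set σ | M.Indep I ∧ j ∈ I}.ncard) /
          {I : Set σ | M.Indep I}.ncard := div_le_div_of_nonneg_right h' hN.le
    _ = 2 * (({I : Set σ | M.Indep I ∧ i ∈ I}.ncard : ℝ) / {I : Set σ | M.Indep I}.ncard) *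
          (({I : Set σ | M.Indep I ∧ j ∈ I}.ncard : ℝ) / {I : Set σ | M.Indep I}.ncard) *
          {I : Set σ | M.Indep I}.ncard := by field_simp

/-- **The same for uniformly random bases (`ν_M` is `2`-Rayleigh, Props. 4.21 and 4.25 via Thm. 3.10)**: for distinct
`i`, `j`, `#{B : i, j ∈ B} · #B(M) ≤ 2 · #{B : i ∈ B} · #{B : j ∈ B}` over the bases of `M`.
[cite: BrandenHuh2019, §4.5 Prop. 4.21, Prop. 4.25 (p. 59); §3.2 Thm. 3.10] -/
theorem ncard_isBase_inter_mul_le (M : Matroid σ) {i j : σ} (hij : i ≠ j) :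
    {B : Set σ | M.IsBase B}.ncard * {B : Set σ | M.IsBase B ∧ i ∈ B ∧ j ∈ B}.ncard ≤
      2 * ({B : Set σ | M.IsBase B ∧ i ∈ B}.ncard * {B : Set σ | M.IsBase B ∧ j ∈ B}.ncard) := by
  obtain ⟨B₀, hB₀⟩ := M.exists_isBase
  have h := (isCRayleigh_two_of_mem_lorentzian (basisGenPoly_mem_lorentzian M hB₀)).eval_mul_eval_pderiv_pderiv_le
    i j (w := fun _ ↦ (1 : ℝ)) fun _ ↦ zero_le_one
  rw [eval_one_basisGenPoly, eval_one_pderiv_pderiv_basisGenPoly M hij, eval_one_pderiv_basisGenPoly,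
    eval_one_pderiv_basisGenPoly] at h
  exact_mod_cast h

end NegativeDependence

/-! ## §4 Definition 4.20 (Lorentzian measures), Proposition 4.21, Proposition 4.25 -/

section Measures

variable {σ : Type*} [Fintype σ] [DecidableEq σ]

/-- **The homogenised partition function `w_0^n Z_μ(w_1/w_0, …, w_n/w_0) = Σ_{S ⊆ [n]} μ(S) w_0^{n-|S|} w^S`** of a
weight `μ` on the subsets of `σ` (`n = |σ|`, `w_0 = w_{none}`), for `Z_μ(w) = Σ_S μ(S) w^S` the partition function.
[cite: BrandenHuh2019, §4.5 Def. 4.20 (p. 59)] -/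
def homPartitionPoly (μ : Set σ → ℝ) : MvPolynomial (Option σ) ℝ := ∑ S : Set σ, monomial (homIndSet S) (μ S)

omit [DecidableEq σ] in
/-- `homPartitionPoly μ` unfolded. [cite: BrandenHuh2019, §4.5 Def. 4.20] -/
theorem homPartitionPoly_def (μ : Set σ → ℝ) :
    homPartitionPoly μ = ∑ S : Set σ, monomial (homIndSet S) (μ S) := rfl

/-- **Brändén–Huh, Definition 4.20 (Lorentzian measures)**: "A discrete probability measure `μ` on `{0,1}^n` is
*Lorentzian* if the homogenization of the partition function `w_0^n Z_μ(w_1/w_0, …, w_n/w_0)` is a Lorentzian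
polynomial" — for the tree's `L^n_{n+1}` (Def. 2.6 = Lorentzian by Thm. 2.25); stated for any weight `μ` (a positive
normalisation is immaterial, `IsLorentzianMeasure.smul`). [cite: BrandenHuh2019, §4.5 Def. 4.20 (p. 59)] -/
def IsLorentzianMeasure (μ : Set σ → ℝ) : Prop := homPartitionPoly μ ∈ lorentzian (Option σ) (Fintype.card σ)

/-- Unfolding Def. 4.20. [cite: BrandenHuh2019, §4.5 Def. 4.20] -/
theorem isLorentzianMeasure_iff (μ : Set σ → ℝ) :
    IsLorentzianMeasure μ ↔ homPartitionPoly μ ∈ lorentzian (Option σ) (Fintype.card σ) := Iff.rfl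

omit [DecidableEq σ] in
/-- The homogenised partition function is linear in the weight: scaling. [cite: BrandenHuh2019, §4.5 Def. 4.20] -/
theorem homPartitionPoly_smul (c : ℝ) (μ : Set σ → ℝ) : homPartitionPoly (c • μ) = c • homPartitionPoly μ := by
  rw [homPartitionPoly, homPartitionPoly, Finset.smul_sum]
  refine Finset.sum_congr rfl fun S _ ↦ ?_
  rw [Pi.smul_apply, smul_eq_mul, smul_monomial, smul_eq_mul]

/-- Lorentzian measures are stable under nonnegative scaling (so the normalisation of a probability measure plays no
role). [cite: BrandenHuh2019, §4.5 Def. 4.20; §2.2 (p. 11, `L^d_n` is a cone)] -/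
theorem IsLorentzianMeasure.smul {μ : Set σ → ℝ} (h : IsLorentzianMeasure μ) {c : ℝ} (hc : 0 ≤ c) :
    IsLorentzianMeasure (c • μ) := by
  rw [IsLorentzianMeasure, homPartitionPoly_smul]
  exact smul_mem_lorentzian h hc

/-- **Brändén–Huh, Proposition 4.21: "If `μ` is Lorentzian, then `μ` is `2`-Rayleigh."** Here as the `2`-Rayleigh
property (Def. 2.18, all `α`) of the homogenised partition function — "Lemma 2.20 and Proposition 2.19 show that `Z_μ`
is a `2(1 - 1/n)`-Rayleigh polynomial", `2(1 - 1/n) ≤ 2`. [cite: BrandenHuh2019, §4.5 Prop. 4.21 (p. 59); §2.4 Prop.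
2.19, Lemma 2.20] -/
theorem IsLorentzianMeasure.isCRayleigh_two {μ : Set σ → ℝ} (h : IsLorentzianMeasure μ) :
    IsCRayleigh 2 (homPartitionPoly μ) :=
  isCRayleigh_two_of_mem_lorentzian h

/-- Proposition 4.21 with the printed constant `2(1 - 1/n)`. [cite: BrandenHuh2019, §4.5 proof of Prop. 4.21] -/
theorem IsLorentzianMeasure.isCRayleigh {μ : Set σ → ℝ} (h : IsLorentzianMeasure μ) :
    IsCRayleigh (2 * (1 - 1 / (Fintype.card σ : ℝ))) (homPartitionPoly μ) :=
  isCRayleigh_of_mem_lorentzian h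

/-- **Proposition 4.21, pointwise**: for a Lorentzian `μ`, distinct or not `i, j`, and every `w` in the closed orthant
of `ℝ^{n+1}` (at `w_0 = 1` this is "`Z_μ(w) ∂_i∂_j Z_μ(w) ≤ 2 ∂_i Z_μ(w) ∂_j Z_μ(w)` for all `w ∈ ℝ^n_{>0}`"):
`F(w) ∂_i∂_j F(w) ≤ 2 ∂_i F(w) ∂_j F(w)` for the homogenised partition function `F`. [cite: BrandenHuh2019, §4.5 Prop.
4.21 and the definition of `c`-Rayleigh measures (p. 59)] -/
theorem IsLorentzianMeasure.eval_mul_le {μ : Set σ → ℝ} (h : IsLorentzianMeasure μ) (i j : σ)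
    {w : Option σ → ℝ} (hw : ∀ k, 0 ≤ w k) :
    eval w (homPartitionPoly μ) * eval w (pderiv (some i) (pderiv (some j) (homPartitionPoly μ))) ≤
      2 * (eval w (pderiv (some i) (homPartitionPoly μ)) * eval w (pderiv (some j) (homPartitionPoly μ))) :=
  h.isCRayleigh_two.eval_mul_eval_pderiv_pderiv_le (some i) (some j) hw

/-- **The weight of the uniform measure on a family of subsets** (up to normalisation): the indicator of the family
(`μ_M`: the independent sets; `ν_M`: the bases). [cite: BrandenHuh2019, §4.5 (definition of `μ_M`, `ν_M`, p. 59)] -/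
def setIndicatorWeight (𝓕 : Set (Set σ)) : Set σ → ℝ := fun S ↦ by
  classical exact if S ∈ 𝓕 then 1 else 0

omit [Fintype σ] [DecidableEq σ] in
/-- `setIndicatorWeight 𝓕 S = [S ∈ 𝓕]`. [cite: BrandenHuh2019, §4.5 (p. 59)] -/
theorem setIndicatorWeight_apply (𝓕 : Set (Set σ)) (S : Set σ) [Decidable (S ∈ 𝓕)] :
    setIndicatorWeight 𝓕 S = if S ∈ 𝓕 then 1 else 0 := by
  unfold setIndicatorWeight
  convert rfl

/-- **The homogenised partition function of `μ_M` is `f_M`** ("the homogenized partition function `f_M` of `μ_M`").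
[cite: BrandenHuh2019, §4.5 proof of Prop. 4.25 (p. 59); §4.3 (`f_M`)] -/
theorem homPartitionPoly_indep (M : Matroid σ) :
    homPartitionPoly (setIndicatorWeight {I | M.Indep I}) = indepGenPoly M := by
  classical
  rw [homPartitionPoly, indepGenPoly, genPoly_def, sum_indepExp]
  rw [← Finset.sum_subset (Finset.subset_univ (indepSetFamily M)) fun S _ hS ↦ by
    rw [setIndicatorWeight_apply, if_neg (fun h : S ∈ {I | M.Indep I} ↦ hS (mem_indepSetFamily.2 h)),
      monomial_zero]]
  refine Finset.sum_congr rfl fun S hS ↦ ?_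
  rw [setIndicatorWeight_apply, if_pos (show S ∈ {I | M.Indep I} from mem_indepSetFamily.1 hS)]

/-- **Brändén–Huh, Proposition 4.25 for `μ_M`: the uniform measure on the independent sets of a matroid is
Lorentzian** ("`μ_M` is Lorentzian by Theorem 4.10": its homogenised partition function is `f_M`, tree
`indepGenPoly_mem_lorentzian`). [cite: BrandenHuh2019, §4.5 Prop. 4.25 (p. 59); §4.3 Thm. 4.10] -/
theorem isLorentzianMeasure_indep (M : Matroid σ) : IsLorentzianMeasure (setIndicatorWeight {I | M.Indep I}) := by
  rw [IsLorentzianMeasure, homPartitionPoly_indep]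
  exact indepGenPoly_mem_lorentzian M

omit [DecidableEq σ] in
/-- `e^♮_B = (n - |B|) e_0 + ι_*(e_B)` with `ι = some`: the homogenised indicator through `Finsupp.mapDomain`.
[cite: BrandenHuh2019, §4.5 Def. 4.20 (`w_0^n Z(w/w_0)`)] -/
theorem homIndSet_eq_single_add_mapDomain (B : Set σ) :
    homIndSet B = Finsupp.single none (Fintype.card σ - B.ncard) + Finsupp.mapDomain Option.some (indSet B) := by
  ext o
  cases o with
  | none =>
    rw [homIndSet_none, Finsupp.add_apply, Finsupp.single_eq_same,
      Finsupp.mapDomain_notin_range _ _ (by simp), add_zero]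
  | some i =>
    rw [homIndSet_some, Finsupp.add_apply, Finsupp.single_eq_of_ne (Option.some_ne_none i),
      Finsupp.mapDomain_apply (Option.some_injective σ), zero_add]

/-- **The homogenised partition function of `ν_M` is `w_0^{n-r} · f_{B(M)}(w_1, …, w_n)`**, `r` the rank.
[cite: BrandenHuh2019, §4.5 proof of Prop. 4.25 ("The partition function of `ν_M` is Lorentzian by Theorem 3.10")] -/
theorem homPartitionPoly_isBase (M : Matroid σ) {B₀ : Set σ} (hB₀ : M.IsBase B₀) :
    homPartitionPoly (setIndicatorWeight {B | M.IsBase B}) =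
      X none ^ (Fintype.card σ - B₀.ncard) * rename Option.some (basisGenPoly M) := by
  classical
  rw [homPartitionPoly, basisGenPoly_def, map_sum, Finset.mul_sum, sum_basesExp]
  rw [← Finset.sum_subset (Finset.subset_univ (baseSetFamily M)) fun S _ hS ↦ by
    rw [setIndicatorWeight_apply, if_neg (fun h : S ∈ {B | M.IsBase B} ↦ hS (mem_baseSetFamily.2 h)),
      monomial_zero]]
  refine Finset.sum_congr rfl fun B hB ↦ ?_
  have hB' : M.IsBase B := mem_baseSetFamily.1 hB
  rw [setIndicatorWeight_apply, if_pos (show B ∈ {B | M.IsBase B} from hB'), rename_monomial,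
    homIndSet_eq_single_add_mapDomain,
    monomial_single_add, hB'.ncard_eq_ncard_of_isBase hB₀]

/-- **Brändén–Huh, Proposition 4.25 for `ν_M`: the uniform measure on the bases of a matroid is Lorentzian** ("The
partition function of `ν_M` is Lorentzian by Theorem 3.10": `w_0^{n-r} f_{B(M)} ∈ L^n_{n+1}` by Thm. 3.10 (tree
`basisGenPoly_mem_lorentzian`), `w_0^{n-r} ∈ L^{n-r}` and products, Cor. 2.32). [cite: BrandenHuh2019, §4.5 Prop. 4.25
(p. 59); §3.2 Thm. 3.10; §2.5 Cor. 2.32] -/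
theorem isLorentzianMeasure_isBase (M : Matroid σ) : IsLorentzianMeasure (setIndicatorWeight {B | M.IsBase B}) := by
  obtain ⟨B₀, hB₀⟩ := M.exists_isBase
  rw [IsLorentzianMeasure, homPartitionPoly_isBase M hB₀]
  have hr : B₀.ncard ≤ Fintype.card σ := ncard_le_card B₀
  have h := mul_mem_lorentzian (X_pow_mem_lorentzian (none : Option σ) (Fintype.card σ - B₀.ncard))
    (rename_mem_lorentzian (Option.some_injective σ) (basisGenPoly_mem_lorentzian M hB₀))
  rwa [Nat.sub_add_cancel hr] at h

end Measures

end Literature.Combinatorics.LorentzianPolynomials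

end
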